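import Summits.QuantumFields.YangMills.Theorems.ColdStartUniversalityUniformColdStartMixingOfChiSquare
import HarnessLib

/-!
# Route `ColdStartUniversality`, crux K_A1 (stmt-QuantumFields-24809), `L²` twin of line «cold_entropy» in the LINE'S OWN SHAPE:
# χ² BUDGET + χ² DISSIPATION along cold-start flows ⇒ `PointwiseMixing`; the uniform `L²` gap (H1) implies the dissipation

Helper file (seat `ym-line-csu-p1`, g16; `--supports stmt-QuantumFields-24809`).  `chiSquareStep` used (H1), a statement about the
transition KERNELS on all bounded measurable observables.  The registered line «cold_entropy» phrases its analytic input purely along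
cold-start flows (`stub_entropyDissipation`: budget `H₀` at physical time `t₀` ⇒ entropy `≤ η` after `t₀ + T`).  Here is the exact χ²
mirror, so the planner can choose either shape:

* ★★ `chiSquareDissipationStep` — (H2 χ² budget, dual form) → (H1′ χ² DISSIPATION along cold-start flows: for all `X₀, η` there are
  `T, K₀` with «dual χ² bound `X₀` at physical time `t₀` ⇒ dual χ² bound `η` at every `s ≥ t₀ + T`», uniformly in `K ≥ K₀`) →
  `PointwiseMixing` VERBATIM (no Markov property needed: Cauchy–Schwarz at the final time);
* ★ `chiSquareDissipation_of_uniformL2Gap` — (H1) → (H1′) (Markov/Chapman–Kolmogorov through THE kernels, invariance of `μ_K`,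
  `X₀ e^{−2cT} ≤ η`).

THEOREMS ONLY, no definition, no sorry.  HONEST FRAMING: implications between HYPOTHESES (all open and K-uniform); nothing K-uniform is
proved; crux K_A1, rung R3 and the summit are NOT proved; the Yang–Mills mass gap is NOT proved.
-/

set_option autoImplicit false

noncomputable section

namespace Summit.QuantumFields.YangMills.Theorems.ColdStartUniversality

open MeasureTheory ProbabilityTheory
open scoped NNReal ENNReal
open Literature.Probability.Process Literature.MathematicalPhysics.QuantumFieldTheory
open Literature.MathematicalPhysics.QuantumLattice (fundamentalRep fundamentalLatticeRep continuous_fundamentalRep)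
open Literature.MathematicalPhysics.QuantumFieldTheory.Balaban1983to89

/-- ★★ **`chiSquareDissipationStep`**: the K-uniform cold-start χ² budget (H2) and the K-uniform χ² dissipation along cold-start
flows (H1′) imply the node `PointwiseMixing` (verbatim).  `γ₁ := min`, `K₀ := max`, `T_c := s₀ + T(X₀, η²)`; at the final time
`|E G₀(U) − μ_K G₀| ≤ √(η² Var G₀) ≤ η` for the loop-string observable `G₀`, `|G₀| ≤ 1`. [folklore] -/
theorem chiSquareDissipationStep :
    (∃ γ₁ : ℝ, 0 < γ₁ ∧ ∀ (F : T3ContinuumYM3Torus.T3Family) (γ : ℝ), 0 < γ → γ ≤ γ₁ →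
      ∃ s₀ X₀ : ℝ, 0 < s₀ ∧ 0 ≤ X₀ ∧ ∃ K₀ : ℕ, ∀ K : ℕ, K₀ ≤ K →
        ∀ (Ω : Type) (mΩ : MeasurableSpace Ω) (P : Measure Ω) (_ : IsProbabilityMeasure P)
          (W : ℝ≥0 → Ω → (Edge 3 ((F.P K).sitesPerDir 0) × NoiseIdx 2 → ℝ)) (hW : IsFlatBrownian W P)
          (U : ℝ≥0 → Ω → GaugeConfig 3 ((F.P K).sitesPerDir 0) (Matrix.specialUnitaryGroup (Fin 2) ℂ)),
          ((∀ ω, U 0 ω = fun _ => 1) ∧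
            (latticeLangevinDynamics (⟨2, fundamentalRep (Fin 2), continuous_fundamentalRep _,
                Literature.MathematicalPhysics.QuantumLattice.fundamentalRep_injective _,
                Literature.MathematicalPhysics.QuantumLattice.fundamentalRep_mem_unitaryGroup⟩ :
                LatticeRep (Matrix.specialUnitaryGroup (Fin 2) ℂ)) ((γ * (F.P K).eps)⁻¹ / 2)).IsSolution
              (fundamentalRep (Fin 2)) hW.natFiltration P W U) →
          ∀ (G : GaugeConfig 3 ((F.P K).sitesPerDir 0) (Matrix.specialUnitaryGroup (Fin 2) ℂ) → ℝ), Measurable G →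
            (∀ x, |G x| ≤ 1) →
            ((∫ ω, G (U (s₀ / (F.P K).eps).toNNReal ω) ∂P) - ∫ z, G z ∂(wilsonMeasure (d := 3) (L := (F.P K).sitesPerDir 0)
                (fundamentalRep (Fin 2)) ((γ * (F.P K).eps)⁻¹ / 2))) ^ 2 ≤
              X₀ * ∫ x, (G x - ∫ z, G z ∂(wilsonMeasure (d := 3) (L := (F.P K).sitesPerDir 0)
                (fundamentalRep (Fin 2)) ((γ * (F.P K).eps)⁻¹ / 2))) ^ 2
                ∂(wilsonMeasure (d := 3) (L := (F.P K).sitesPerDir 0) (fundamentalRep (Fin 2)) ((γ * (F.P K).eps)⁻¹ / 2))) →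
    (∃ γ₁ : ℝ, 0 < γ₁ ∧ ∀ (F : T3ContinuumYM3Torus.T3Family) (γ : ℝ), 0 < γ → γ ≤ γ₁ →
      ∀ (X₀ η : ℝ), 0 ≤ X₀ → 0 < η →
        ∃ T : ℝ, 0 < T ∧ ∃ K₀ : ℕ, ∀ K : ℕ, K₀ ≤ K →
          ∀ (Ω : Type) (mΩ : MeasurableSpace Ω) (P : Measure Ω) (_ : IsProbabilityMeasure P)
            (W : ℝ≥0 → Ω → (Edge 3 ((F.P K).sitesPerDir 0) × NoiseIdx 2 → ℝ)) (hW : IsFlatBrownian W P)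
            (U : ℝ≥0 → Ω → GaugeConfig 3 ((F.P K).sitesPerDir 0) (Matrix.specialUnitaryGroup (Fin 2) ℂ)),
            ((∀ ω, U 0 ω = fun _ => 1) ∧
              (latticeLangevinDynamics (⟨2, fundamentalRep (Fin 2), continuous_fundamentalRep _,
                  Literature.MathematicalPhysics.QuantumLattice.fundamentalRep_injective _,
                  Literature.MathematicalPhysics.QuantumLattice.fundamentalRep_mem_unitaryGroup⟩ :
                  LatticeRep (Matrix.specialUnitaryGroup (Fin 2) ℂ)) ((γ * (F.P K).eps)⁻¹ / 2)).IsSolution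
                (fundamentalRep (Fin 2)) hW.natFiltration P W U) →
            ∀ t₀ : ℝ, 0 ≤ t₀ →
              (∀ (G : GaugeConfig 3 ((F.P K).sitesPerDir 0) (Matrix.specialUnitaryGroup (Fin 2) ℂ) → ℝ), Measurable G →
                (∀ x, |G x| ≤ 1) →
                ((∫ ω, G (U (t₀ / (F.P K).eps).toNNReal ω) ∂P) - ∫ z, G z ∂(wilsonMeasure (d := 3) (L := (F.P K).sitesPerDir 0)
                    (fundamentalRep (Fin 2)) ((γ * (F.P K).eps)⁻¹ / 2))) ^ 2 ≤
                  X₀ * ∫ x, (G x - ∫ z, G z ∂(wilsonMeasure (d := 3) (L := (F.P K).sitesPerDir 0)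
                    (fundamentalRep (Fin 2)) ((γ * (F.P K).eps)⁻¹ / 2))) ^ 2
                    ∂(wilsonMeasure (d := 3) (L := (F.P K).sitesPerDir 0) (fundamentalRep (Fin 2)) ((γ * (F.P K).eps)⁻¹ / 2))) →
              ∀ s : ℝ, t₀ + T ≤ s →
              ∀ (G : GaugeConfig 3 ((F.P K).sitesPerDir 0) (Matrix.specialUnitaryGroup (Fin 2) ℂ) → ℝ), Measurable G →
                (∀ x, |G x| ≤ 1) →
                ((∫ ω, G (U (s / (F.P K).eps).toNNReal ω) ∂P) - ∫ z, G z ∂(wilsonMeasure (d := 3) (L := (F.P K).sitesPerDir 0)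
                    (fundamentalRep (Fin 2)) ((γ * (F.P K).eps)⁻¹ / 2))) ^ 2 ≤
                  η * ∫ x, (G x - ∫ z, G z ∂(wilsonMeasure (d := 3) (L := (F.P K).sitesPerDir 0)
                    (fundamentalRep (Fin 2)) ((γ * (F.P K).eps)⁻¹ / 2))) ^ 2
                    ∂(wilsonMeasure (d := 3) (L := (F.P K).sitesPerDir 0) (fundamentalRep (Fin 2)) ((γ * (F.P K).eps)⁻¹ / 2))) →
    (∃ γ₁ : ℝ, 0 < γ₁ ∧ ∀ (F : T3ContinuumYM3Torus.T3Family) (γ : ℝ), 0 < γ → γ ≤ γ₁ →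
      ∀ (os : List (T3ContinuumYM3Torus.ULoop3 F)) (η : ℝ), 0 < η →
        ∃ Tc : ℝ, 0 < Tc ∧ ∃ K₀ : ℕ, ∀ K : ℕ, K₀ ≤ K →
          ∀ (Ω : Type) (mΩ : MeasurableSpace Ω) (P : Measure Ω) (_ : IsProbabilityMeasure P)
            (W : ℝ≥0 → Ω → (Edge 3 ((F.P K).sitesPerDir 0) × NoiseIdx 2 → ℝ)) (hW : IsFlatBrownian W P)
            (U : ℝ≥0 → Ω → GaugeConfig 3 ((F.P K).sitesPerDir 0) (Matrix.specialUnitaryGroup (Fin 2) ℂ)),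
            ((∀ ω, U 0 ω = fun _ => 1) ∧
              (latticeLangevinDynamics (⟨2, fundamentalRep (Fin 2), continuous_fundamentalRep _,
                  Literature.MathematicalPhysics.QuantumLattice.fundamentalRep_injective _,
                  Literature.MathematicalPhysics.QuantumLattice.fundamentalRep_mem_unitaryGroup⟩ :
                  LatticeRep (Matrix.specialUnitaryGroup (Fin 2) ℂ)) ((γ * (F.P K).eps)⁻¹ / 2)).IsSolution
                (fundamentalRep (Fin 2)) hW.natFiltration P W U) →
              ∀ s : ℝ, Tc ≤ s →
                |(F.scheme (ExpMeanLog.expMeanLogSU : LoopAverage (Matrix.specialUnitaryGroup (Fin 2) ℂ)) γ).expectAt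
                      K os -
                    ∫ ω, (os.map fun C => F.avgObs (ExpMeanLog.expMeanLogSU :
                        LoopAverage (Matrix.specialUnitaryGroup (Fin 2) ℂ)) K C
                      (fun b : PBond (F.P K) 0 => U (s / (F.P K).eps).toNNReal ω (b.src, b.dir))).prod ∂P| ≤ η) := by
  rintro ⟨γb, hγb, hB⟩ ⟨γa, hγa, hA⟩
  refine ⟨min γa γb, lt_min hγa hγb, fun F γ hγ hγle os η hη => ?_⟩
  obtain ⟨s₀, X₀, hs₀, hX₀, Kb, hKb⟩ := hB F γ hγ (hγle.trans (min_le_right _ _))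
  obtain ⟨T, hT, Ka, hKa⟩ := hA F γ hγ (hγle.trans (min_le_left _ _)) X₀ (η ^ 2) hX₀ (by positivity)
  refine ⟨s₀ + T, by positivity, max Ka Kb, fun K hK => ?_⟩
  classical
  set Lk : ℕ := (F.P K).sitesPerDir 0 with hLk
  haveI := secondCountableTopology_su2
  haveI := borelSpace_config Lk
  set μ : Measure (GaugeConfig 3 Lk (Matrix.specialUnitaryGroup (Fin 2) ℂ)) :=
    wilsonMeasure (d := 3) (L := Lk) (fundamentalRep (Fin 2)) ((γ * (F.P K).eps)⁻¹ / 2) with hμ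
  haveI hμP : IsProbabilityMeasure μ :=
    isProbabilityMeasure_wilsonMeasure (d := 3) (L := Lk) (fundamentalRep (Fin 2)) (continuous_fundamentalRep (Fin 2)) _
  set S := F.scheme (ExpMeanLog.expMeanLogSU : LoopAverage (Matrix.specialUnitaryGroup (Fin 2) ℂ)) γ with hS
  have hβK : ∀ K', 0 ≤ S.β K' := fun K' => F.scheme_β_nonneg _ hγ.le K'
  set dict : GaugeConfig 3 Lk (Matrix.specialUnitaryGroup (Fin 2) ℂ) → GaugeField (F.P K) 0 (Matrix.specialUnitaryGroup (Fin 2) ℂ) :=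
    fun V => fun b : PBond (F.P K) 0 => V (b.src, b.dir) with hdict
  have hΦ : Measurable dict := measurable_pi_lambda _ fun b => measurable_pi_apply _
  set f : GaugeField (F.P K) 0 (Matrix.specialUnitaryGroup (Fin 2) ℂ) → ℝ :=
    fun V => (os.map fun C => F.avgObs (ExpMeanLog.expMeanLogSU :
        LoopAverage (Matrix.specialUnitaryGroup (Fin 2) ℂ)) K C V).prod with hf
  have hm : ∀ K' C, Measurable (S.obs K' C) := fun K' C =>
    F.measurable_avgObs (F.avgMeasurable_of_measurableE _ T4ApexTwoLevel.measurableE_expMeanLogSU) K' C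
  have hfm : Measurable f := T4GenFunBounds.measurable_prodObs S hm K os
  have hfb : ∀ V, |f V| ≤ 1 := fun V =>
    T4GenFunBounds.abs_prodObs_le_one S (fun K' C U => F.abs_avgObs_le_one _ K' C U) K os V
  set G₀ : GaugeConfig 3 Lk (Matrix.specialUnitaryGroup (Fin 2) ℂ) → ℝ := fun V => f (dict V) with hG₀
  have hG₀m : Measurable G₀ := hfm.comp hΦ
  have hG₀b : ∀ V, |G₀ V| ≤ 1 := fun V => hfb _
  have hE : S.expectAt K os = ∫ V, G₀ V ∂μ := by
    have hE0 : S.expectAt K os = ∫ V, f V ∂(T4GenFunBounds.gibbsMeasure (F.P K) (S.β K)) :=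
      T4GenFunBounds.expectAt_eq_integral_gibbs S hβK K os
    have hG : T4GenFunBounds.gibbsMeasure (F.P K) (S.β K) = μ.map dict :=
      gibbsMeasure_eq_map_wilsonMeasure (F.P K) (hβK K)
    rw [hE0, hG, integral_map hΦ.aemeasurable hfm.aestronglyMeasurable]
  intro Ω mΩ P hP W hW U hU s hs
  have hbud := hKb K ((le_max_right _ _).trans hK) Ω mΩ P hP W hW U hU
  have hdis := hKa K ((le_max_left _ _).trans hK) Ω mΩ P hP W hW U hU s₀ hs₀.le hbud s hs G₀ hG₀m hG₀b
  have hV1 : ∫ x, (G₀ x - ∫ z, G₀ z ∂μ) ^ 2 ∂μ ≤ 1 := integral_sub_integral_sq_le_one μ hG₀m hG₀b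
  have hfin : ((∫ ω, G₀ (U (s / (F.P K).eps).toNNReal ω) ∂P) - ∫ V, G₀ V ∂μ) ^ 2 ≤ η ^ 2 :=
    hdis.trans ((mul_le_mul_of_nonneg_left hV1 (by positivity)).trans (by rw [mul_one]))
  have hfX : (fun ω => (os.map fun C => F.avgObs (ExpMeanLog.expMeanLogSU :
      LoopAverage (Matrix.specialUnitaryGroup (Fin 2) ℂ)) K C
        (fun b : PBond (F.P K) 0 => U (s / (F.P K).eps).toNNReal ω (b.src, b.dir))).prod) =
      fun ω => G₀ (U (s / (F.P K).eps).toNNReal ω) := rfl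
  rw [hfX, hE]
  have habs := Real.sqrt_le_sqrt hfin
  rw [Real.sqrt_sq_eq_abs, Real.sqrt_sq hη.le] at habs
  rwa [abs_sub_comm] at habs

/-- ★ **(H1) ⇒ (H1′)**: a K-uniform `L²(μ_K)` spectral gap in physical units implies K-uniform χ² dissipation along every cold-start flow,
with `T` such that `X₀ e^{−2cT} ≤ η` (Markov/Chapman–Kolmogorov through THE transition kernels, the dual bound at `t₀` applied to the
propagated observable `κ_t G`, invariance `μ_K(κ_t G) = μ_K G`). [cite: RobertsRosenthal1997, Theorem 2.1] -/
theorem chiSquareDissipation_of_uniformL2Gap :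
    (∃ γ₁ : ℝ, 0 < γ₁ ∧ ∀ (F : T3ContinuumYM3Torus.T3Family) (γ : ℝ), 0 < γ → γ ≤ γ₁ →
      ∃ c : ℝ, 0 < c ∧ ∃ K₀ : ℕ, ∀ K : ℕ, K₀ ≤ K →
        ∀ (κ : ℝ≥0 → Kernel (GaugeConfig 3 ((F.P K).sitesPerDir 0) (Matrix.specialUnitaryGroup (Fin 2) ℂ))
            (GaugeConfig 3 ((F.P K).sitesPerDir 0) (Matrix.specialUnitaryGroup (Fin 2) ℂ))) [∀ t, IsMarkovKernel (κ t)],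
          (∀ (t : ℝ≥0) (x : GaugeConfig 3 ((F.P K).sitesPerDir 0) (Matrix.specialUnitaryGroup (Fin 2) ℂ))
            (Ω : Type) [MeasurableSpace Ω] (P : Measure Ω) [IsProbabilityMeasure P]
            (W : ℝ≥0 → Ω → (Edge 3 ((F.P K).sitesPerDir 0) × NoiseIdx 2 → ℝ)) (hW : IsFlatBrownian W P)
            (U : ℝ≥0 → Ω → GaugeConfig 3 ((F.P K).sitesPerDir 0) (Matrix.specialUnitaryGroup (Fin 2) ℂ)),
            (∀ ω, U 0 ω = x) →
            (latticeLangevinDynamics (fundamentalLatticeRep 2) ((γ * (F.P K).eps)⁻¹ / 2)).IsSolution (fundamentalRep (Fin 2))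
              hW.natFiltration P W U →
            κ t x = P.map (U t)) →
          ∀ (G : GaugeConfig 3 ((F.P K).sitesPerDir 0) (Matrix.specialUnitaryGroup (Fin 2) ℂ) → ℝ), Measurable G →
            (∀ x, |G x| ≤ 1) → ∀ t : ℝ≥0,
            ∫ x, ((∫ y, G y ∂(κ t x)) - ∫ z, G z ∂(wilsonMeasure (d := 3) (L := (F.P K).sitesPerDir 0)
                (fundamentalRep (Fin 2)) ((γ * (F.P K).eps)⁻¹ / 2))) ^ 2
                ∂(wilsonMeasure (d := 3) (L := (F.P K).sitesPerDir 0) (fundamentalRep (Fin 2)) ((γ * (F.P K).eps)⁻¹ / 2)) ≤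
              Real.exp (-2 * c * ((F.P K).eps * t)) *
                ∫ x, (G x - ∫ z, G z ∂(wilsonMeasure (d := 3) (L := (F.P K).sitesPerDir 0)
                  (fundamentalRep (Fin 2)) ((γ * (F.P K).eps)⁻¹ / 2))) ^ 2
                  ∂(wilsonMeasure (d := 3) (L := (F.P K).sitesPerDir 0) (fundamentalRep (Fin 2)) ((γ * (F.P K).eps)⁻¹ / 2))) →
    (∃ γ₁ : ℝ, 0 < γ₁ ∧ ∀ (F : T3ContinuumYM3Torus.T3Family) (γ : ℝ), 0 < γ → γ ≤ γ₁ →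
      ∀ (X₀ η : ℝ), 0 ≤ X₀ → 0 < η →
        ∃ T : ℝ, 0 < T ∧ ∃ K₀ : ℕ, ∀ K : ℕ, K₀ ≤ K →
          ∀ (Ω : Type) (mΩ : MeasurableSpace Ω) (P : Measure Ω) (_ : IsProbabilityMeasure P)
            (W : ℝ≥0 → Ω → (Edge 3 ((F.P K).sitesPerDir 0) × NoiseIdx 2 → ℝ)) (hW : IsFlatBrownian W P)
            (U : ℝ≥0 → Ω → GaugeConfig 3 ((F.P K).sitesPerDir 0) (Matrix.specialUnitaryGroup (Fin 2) ℂ)),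
            ((∀ ω, U 0 ω = fun _ => 1) ∧
              (latticeLangevinDynamics (⟨2, fundamentalRep (Fin 2), continuous_fundamentalRep _,
                  Literature.MathematicalPhysics.QuantumLattice.fundamentalRep_injective _,
                  Literature.MathematicalPhysics.QuantumLattice.fundamentalRep_mem_unitaryGroup⟩ :
                  LatticeRep (Matrix.specialUnitaryGroup (Fin 2) ℂ)) ((γ * (F.P K).eps)⁻¹ / 2)).IsSolution
                (fundamentalRep (Fin 2)) hW.natFiltration P W U) →
            ∀ t₀ : ℝ, 0 ≤ t₀ →
              (∀ (G : GaugeConfig 3 ((F.P K).sitesPerDir 0) (Matrix.specialUnitaryGroup (Fin 2) ℂ) → ℝ), Measurable G →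
                (∀ x, |G x| ≤ 1) →
                ((∫ ω, G (U (t₀ / (F.P K).eps).toNNReal ω) ∂P) - ∫ z, G z ∂(wilsonMeasure (d := 3) (L := (F.P K).sitesPerDir 0)
                    (fundamentalRep (Fin 2)) ((γ * (F.P K).eps)⁻¹ / 2))) ^ 2 ≤
                  X₀ * ∫ x, (G x - ∫ z, G z ∂(wilsonMeasure (d := 3) (L := (F.P K).sitesPerDir 0)
                    (fundamentalRep (Fin 2)) ((γ * (F.P K).eps)⁻¹ / 2))) ^ 2
                    ∂(wilsonMeasure (d := 3) (L := (F.P K).sitesPerDir 0) (fundamentalRep (Fin 2)) ((γ * (F.P K).eps)⁻¹ / 2))) →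
              ∀ s : ℝ, t₀ + T ≤ s →
              ∀ (G : GaugeConfig 3 ((F.P K).sitesPerDir 0) (Matrix.specialUnitaryGroup (Fin 2) ℂ) → ℝ), Measurable G →
                (∀ x, |G x| ≤ 1) →
                ((∫ ω, G (U (s / (F.P K).eps).toNNReal ω) ∂P) - ∫ z, G z ∂(wilsonMeasure (d := 3) (L := (F.P K).sitesPerDir 0)
                    (fundamentalRep (Fin 2)) ((γ * (F.P K).eps)⁻¹ / 2))) ^ 2 ≤
                  η * ∫ x, (G x - ∫ z, G z ∂(wilsonMeasure (d := 3) (L := (F.P K).sitesPerDir 0)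
                    (fundamentalRep (Fin 2)) ((γ * (F.P K).eps)⁻¹ / 2))) ^ 2
                    ∂(wilsonMeasure (d := 3) (L := (F.P K).sitesPerDir 0) (fundamentalRep (Fin 2)) ((γ * (F.P K).eps)⁻¹ / 2))) := by
  rintro ⟨γ₁, hγ₁, hA⟩
  refine ⟨γ₁, hγ₁, fun F γ hγ hγle X₀ η hX₀ hη => ?_⟩
  obtain ⟨c, hc, K₀, hK⟩ := hA F γ hγ hγle
  -- the physical horizon `T` with `X₀ e^{-2cT} ≤ η`
  set T : ℝ := max 1 (Real.log ((X₀ + 1) / η) / (2 * c)) with hT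
  have hT1 : 1 ≤ T := le_max_left _ _
  have hT0 : 0 < T := lt_of_lt_of_le one_pos hT1
  have hexpT : ∀ τ : ℝ, T ≤ τ → X₀ * Real.exp (-2 * c * τ) ≤ η := by
    intro τ hτ
    have hlog : Real.log ((X₀ + 1) / η) ≤ 2 * c * τ := by
      have h := le_trans (le_max_right _ _) hτ
      rw [div_le_iff₀ (by positivity)] at h
      linarith [mul_comm τ (2 * c)]
    have h1 : Real.exp (-2 * c * τ) ≤ Real.exp (-Real.log ((X₀ + 1) / η)) := Real.exp_le_exp.2 (by linarith)
    rw [Real.exp_neg, Real.exp_log (by positivity), inv_div] at h1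
    calc X₀ * Real.exp (-2 * c * τ) ≤ X₀ * (η / (X₀ + 1)) := mul_le_mul_of_nonneg_left h1 hX₀
      _ ≤ (X₀ + 1) * (η / (X₀ + 1)) := mul_le_mul_of_nonneg_right (by linarith) (by positivity)
      _ = η := mul_div_cancel₀ _ (by positivity)
  refine ⟨T, hT0, K₀, fun K hKK => ?_⟩
  classical
  set ε : ℝ := (F.P K).eps with hεdef
  have hε : 0 < ε := (F.P K).eps_pos
  set β' : ℝ := (γ * ε)⁻¹ / 2 with hβ'
  set Lk : ℕ := (F.P K).sitesPerDir 0 with hLk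
  haveI := secondCountableTopology_su2
  haveI := borelSpace_config Lk
  set μ : Measure (GaugeConfig 3 Lk (Matrix.specialUnitaryGroup (Fin 2) ℂ)) :=
    wilsonMeasure (d := 3) (L := Lk) (fundamentalRep (Fin 2)) β' with hμ
  haveI hμP : IsProbabilityMeasure μ :=
    isProbabilityMeasure_wilsonMeasure (d := 3) (L := Lk) (fundamentalRep (Fin 2)) (continuous_fundamentalRep (Fin 2)) β'
  obtain ⟨κ, hκ, -, hreal⟩ := exists_transitionKernel Lk β'
  haveI := hκ
  intro Ω mΩ P hP W hW U hU t₀ ht₀ hbud s hs G hG hG1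
  obtain ⟨hU0, hsol⟩ := hU
  -- lattice times `u₀ = t₀/ε`, `s/ε = u₀ + t`, `ε t = s − t₀ ≥ T`
  have htr : 0 ≤ (s - t₀) / ε := div_nonneg (by linarith) hε.le
  set u₀ : ℝ≥0 := (t₀ / ε).toNNReal with hu₀
  set t : ℝ≥0 := ((s - t₀) / ε).toNNReal with htdef
  have hsplit : (s / (F.P K).eps).toNNReal = u₀ + t := by
    rw [hu₀, htdef, ← Real.toNNReal_add (by positivity) htr]
    congr 1
    rw [← hεdef]
    field_simp
    ring
  have hεt : ε * (t : ℝ) = s - t₀ := by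
    rw [htdef, Real.coe_toNNReal _ htr]
    field_simp
  -- the propagated observable
  set G₁ : GaugeConfig 3 Lk (Matrix.specialUnitaryGroup (Fin 2) ℂ) → ℝ := fun x => ∫ y, G y ∂(κ t x) with hG₁
  have hG₁m : Measurable G₁ := (hG.stronglyMeasurable.integral_kernel (κ := κ t)).measurable
  have hG₁b : ∀ x, |G₁ x| ≤ 1 := fun x => abs_integral_le_of_abs_le_of_isProbabilityMeasure hG1
  have hGi : ∀ (ν : Measure (GaugeConfig 3 Lk (Matrix.specialUnitaryGroup (Fin 2) ℂ))) [IsProbabilityMeasure ν],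
      Integrable G ν := fun ν _ => integrable_of_abs_le ν hG hG1
  have hmU : ∀ u : ℝ≥0, Measurable (U u) := fun u => (hsol.adapted u).mono (hW.natFiltration.le u) le_rfl
  have hMarkov : ∫ ω, G (U (u₀ + t) ω) ∂P = ∫ ω, G₁ (U u₀ ω) ∂P := by
    rw [← integral_map (hmU (u₀ + t)).aemeasurable hG.aestronglyMeasurable,
      ← integral_map (hmU u₀).aemeasurable hG₁m.aestronglyMeasurable,
      ← hreal (u₀ + t) (fun _ => 1) Ω P W hW U hU0 hsol, ← hreal u₀ (fun _ => 1) Ω P W hW U hU0 hsol,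
      chapmanKolmogorov_szz β' κ hreal u₀ t]
    haveI : IsProbabilityMeasure ((κ t ∘ₖ κ u₀) (fun _ => 1)) := by
      rw [← chapmanKolmogorov_szz β' κ hreal u₀ t]; infer_instance
    exact Kernel.integral_comp (hGi _)
  have hinv : ∫ x, G₁ x ∂μ = ∫ x, G x ∂μ :=
    integral_transitionKernel_integral_eq_wilson (L := Lk) β' κ hreal t hG ⟨1, hG1⟩
  have h2 := hbud G₁ hG₁m hG₁b
  have h1 := hK K hKK κ hreal G hG hG1 t
  rw [hsplit, hMarkov]
  calc ((∫ ω, G₁ (U u₀ ω) ∂P) - ∫ x, G x ∂μ) ^ 2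
      = ((∫ ω, G₁ (U u₀ ω) ∂P) - ∫ x, G₁ x ∂μ) ^ 2 := by rw [hinv]
    _ ≤ X₀ * ∫ x, (G₁ x - ∫ z, G₁ z ∂μ) ^ 2 ∂μ := h2
    _ = X₀ * ∫ x, ((∫ y, G y ∂(κ t x)) - ∫ z, G z ∂μ) ^ 2 ∂μ := by rw [hinv]
    _ ≤ X₀ * (Real.exp (-2 * c * (ε * t)) * ∫ x, (G x - ∫ z, G z ∂μ) ^ 2 ∂μ) := mul_le_mul_of_nonneg_left h1 hX₀
    _ = (X₀ * Real.exp (-2 * c * (s - t₀))) * ∫ x, (G x - ∫ z, G z ∂μ) ^ 2 ∂μ := by rw [hεt]; ring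
    _ ≤ η * ∫ x, (G x - ∫ z, G z ∂μ) ^ 2 ∂μ :=
        mul_le_mul_of_nonneg_right (hexpT (s - t₀) (by linarith)) (integral_nonneg fun x => sq_nonneg _)

end Summit.QuantumFields.YangMills.Theorems.ColdStartUniversality

end
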